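import Summits.SmoothPoincare4.SmoothPoincare4.Theorems.ConvexBisectionAcyclicBisectionRigidityCancelPairRearrange
import HarnessLib

/-!
# Cancelling a transverse `k/(k+1)` pair of critical points of a nice Morse function on a cobordism

Helper file (lead c1, crux `ConvexBisection.AcyclicBisectionRigidity`, item
stmt-SmoothPoincare4-10507).  The cross-seam levers of the round-2 lines (`stub_seamPairDichotomy`,
`stub_crossCancellation`) conclude by CANCELLING a 1-handle of one half against a dual 2-handle of the
other; with Milnor's First Cancellation Theorem proved in the tree
(`Cobordism.Milnor1965_firstCancellation_slab_holds`) the cancellation itself is a theorem, and only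
the GEOMETRIC DUALITY ("the transported dual meets the belt sphere once, transversely" = Milnor's
Def. 5.1: `S_R(p) ∩ S_L(q)` is one point, transversely, in the intermediate level) remains
conjectural.  This file packages Milnor's Thm. 5.4 in any index, exactly as the tree does for
index `0` (`Cobordism.Milnor1965_cancel_pair_index_zero_of_parts`, `HCobordismCancelStep.lean`):

* `cancel_pair_of_isTransverseInLevel` — on a cobordism `c = (W; M, N)` with a NICE Morse
  function `g` and a smooth gradient-like field `ξ`, if `p`, `q` are critical of indices `k`,
  `k + 1` and in Milnor's level `V_{k+} = g⁻¹(plusLevel n k)` the right-hand sphere of `p` and the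
  left-hand sphere of `q` meet in a single point, transversely (`IsTransverseInLevel`), then there
  is a nice Morse function `g'` on `c` with critical set `crit g ∖ {p, q}` and the old indices.
  Proof: `exists_raise_criticalPoint` (4.2) raises `p` above the other critical points of index `k`,
  4.2 again lowers `q` below the other ones of index `k + 1`, without touching `V_{k+}` and the
  spheres in it; 5.4 on the slab between the new levels of `p` and `q` removes both; 4.8
  (`Milnor1965_finalRearrangement_holds`) makes the result nice.  No named fact remains.

Everything is proved; no definitions. [cite: MilnorHCobordism1965, Thm. 5.4 (PDF p. 27), Thms. 4.1/4.2 (PDF pp. 22–23), Thm. 4.8 (PDF p. 25); pattern of PDF p. 57]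
-/

open scoped Manifold ContDiff Topology
open Set Function Filter

noncomputable section

-- the prescribed namespace `Summit.<P>.<Sub>.…` duplicates `SmoothPoincare4` (P = Sub)
set_option linter.dupNamespace false

namespace Summit.SmoothPoincare4.SmoothPoincare4.Theorems.AcyclicBisectionRigidity.Cancellation

open Literature.Topology.FourManifolds Literature.Topology.FourManifolds.Cobordism

universe u

section Cancel

variable {n : ℕ} {M N : Type u} [TopologicalSpace M] [T2Space M] [SecondCountableTopology M]
  [ChartedSpace (EuclideanSpace ℝ (Fin n)) M] [IsManifold (𝓡 n) ∞ M] [CompactSpace M]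
  [TopologicalSpace N] [T2Space N] [SecondCountableTopology N]
  [ChartedSpace (EuclideanSpace ℝ (Fin n)) N] [IsManifold (𝓡 n) ∞ N] [CompactSpace N]


/-- **Milnor's First Cancellation Theorem for a nice Morse function, any index** (Milnor 1965,
Thm. 5.4 with Thms. 4.2 and 4.8, pattern of the proof of Thm. 8.1 / PDF p. 57).  On a cobordism
`c` with a nice Morse function `g` and a smooth gradient-like field `ξ`, let `p`, `q` be critical
points of indices `k`, `k + 1` whose right-hand and left-hand spheres in `V_{k+} = g⁻¹(plusLevel n k)`
meet in exactly one point, transversely.  Then some nice Morse function `g'` on `c` has critical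
set `crit g ∖ {p, q}`, with the same indices.  (Adapted line by line from the tree's index-`0`
case `Cobordism.Milnor1965_cancel_pair_index_zero_of_parts`, the openness substitute for
transversality there being replaced by the hypothesis `htr`; the four ingredients 4.2, 5.4, 4.8
and the invariant function of 4.1 are the tree's discharged theorems.)
[cite: MilnorHCobordism1965, Thm. 5.4 (PDF p. 27); Thms. 4.1, 4.2 (PDF pp. 22–23); Thm. 4.8 (PDF p. 25)] -/
theorem cancel_pair_of_isTransverseInLevel {c : Cobordism n M N} {g : c.W → ℝ}
    (hg : c.IsNiceMorseFunction g)
    (ξ : Cₛ^∞⟮𝓡∂ (n + 1); EuclideanSpace ℝ (Fin (n + 1)), (TangentSpace (𝓡∂ (n + 1)) : c.W → Type)⟯)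
    (hξ : IsGradientLike (𝓡∂ (n + 1)) g ξ) {p q : c.W} {k : ℕ}
    (hp : p ∈ criticalSetOfIndex (𝓡∂ (n + 1)) g k) (hq : q ∈ criticalSetOfIndex (𝓡∂ (n + 1)) g (k + 1))
    {x₀ : c.W}
    (hx₀ : rightHandSphere (𝓡∂ (n + 1)) g ξ p (plusLevel n k) ∩
      leftHandSphere (𝓡∂ (n + 1)) g ξ q (plusLevel n k) = {x₀})
    (htr : IsTransverseInLevel (𝓡∂ (n + 1)) (g ⁻¹' {plusLevel n k})
      (rightHandSphere (𝓡∂ (n + 1)) g ξ p (plusLevel n k))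
      (leftHandSphere (𝓡∂ (n + 1)) g ξ q (plusLevel n k)) x₀) :
    ∃ g' : c.W → ℝ, c.IsNiceMorseFunction g' ∧
      criticalSet (𝓡∂ (n + 1)) g' = criticalSet (𝓡∂ (n + 1)) g \ {p, q} ∧
      ∀ z ∈ criticalSet (𝓡∂ (n + 1)) g', morseIndex (𝓡∂ (n + 1)) g' z = morseIndex (𝓡∂ (n + 1)) g z := by
  -- adapted from `Literature.Topology.FourManifolds.Cobordism.Milnor1965_cancel_pair_index_zero_of_parts`
  -- (Literature/Topology/FourManifolds/HCobordismCancelStep.lean), general index `k`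
  have h42 : Cobordism.Milnor1965_rearrangement_slab.{u} :=
    Cobordism.Milnor1965_rearrangement_slab_of_invariantFunction
      Cobordism.Milnor1965_exists_invariantFunction_holds
  have h54 : Cobordism.Milnor1965_firstCancellation_slab.{u} :=
    Cobordism.Milnor1965_firstCancellation_slab_holds
  have hR : Cobordism.Milnor1965_finalRearrangement.{u} := Cobordism.Milnor1965_finalRearrangement_holds
  -- the index `k + 1` of `q` is at most `dim W = n + 1`
  have hkn : k ≤ n := by
    have h := morseIndex_le_finrank (𝓡∂ (n + 1)) g q
    rw [hq.2, finrank_euclideanSpace_fin] at h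
    omega
  -- levels
  have hLmono : StrictMono (niceLevel n) := niceLevel_strictMono n
  have hLkVk : niceLevel n k < plusLevel n k := niceLevel_lt_plusLevel n k
  have hVkL1 : plusLevel n k < niceLevel n (k + 1) := plusLevel_lt_niceLevel_succ n k
  have hL1V1 : niceLevel n (k + 1) < plusLevel n (k + 1) := niceLevel_lt_plusLevel n (k + 1)
  have hL1lt1 : niceLevel n (k + 1) < 1 := niceLevel_lt_one (by omega)
  have hn2 : (0 : ℝ) < n + 2 := by positivity
  have hV1le1 : plusLevel n (k + 1) ≤ 1 := by
    rw [plusLevel_def, div_le_one hn2]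
    have : (k : ℝ) ≤ n := by exact_mod_cast hkn
    push_cast; linarith
  have hVkpos : 0 < plusLevel n k := by rw [plusLevel_def]; positivity
  have hVklt1 : plusLevel n k < 1 := hVkL1.trans hL1lt1
  -- the field is `C¹`; values and indices of the critical points of the nice `g`
  have hv : ContMDiff (𝓡∂ (n + 1)) (𝓡∂ (n + 1)).tangent 1
      (fun y ↦ (⟨y, ξ y⟩ : TangentBundle (𝓡∂ (n + 1)) c.W)) :=
    ξ.contMDiff.of_le (WithTop.coe_le_coe.mpr le_top)
  have hval : ∀ z ∈ criticalSet (𝓡∂ (n + 1)) g,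
      g z = niceLevel n (morseIndex (𝓡∂ (n + 1)) g z) := fun z hz => hg.2 z hz
  have hpc : p ∈ criticalSet (𝓡∂ (n + 1)) g := hp.1
  have hqc : q ∈ criticalSet (𝓡∂ (n + 1)) g := hq.1
  have hpval : g p = niceLevel n k := by rw [hval p hpc, hp.2]
  have hqval : g q = niceLevel n (k + 1) := by rw [hval q hqc, hq.2]
  have hqp : q ≠ p := by
    rintro rfl
    have h := hp.2.symm.trans hq.2
    omega
  -- Step 1 (`exists_raise_criticalPoint`): raise `p` above the other critical points of index `k`.
  obtain ⟨g₁, a₀, hg₁, hξ₁, hcrit₁, hind₁, ha₀, ha₀p, hpB, hoth₁, hlev₁, hold₁⟩ :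
      ∃ g₁ : c.W → ℝ, ∃ a₀ : ℝ, c.IsMorseFunction g₁ ∧ IsGradientLike (𝓡∂ (n + 1)) g₁ ξ ∧
        criticalSet (𝓡∂ (n + 1)) g₁ = criticalSet (𝓡∂ (n + 1)) g ∧
        (∀ z ∈ criticalSet (𝓡∂ (n + 1)) g,
          morseIndex (𝓡∂ (n + 1)) g₁ z = morseIndex (𝓡∂ (n + 1)) g z) ∧
        0 < a₀ ∧ a₀ < g₁ p ∧ g₁ p < plusLevel n k ∧
        (∀ z ∈ criticalSet (𝓡∂ (n + 1)) g₁, z ≠ p → g₁ z ∉ Icc a₀ (plusLevel n k)) ∧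
        (∀ z, g₁ z = plusLevel n k ↔ g z = plusLevel n k) ∧
        (∀ z ∈ criticalSet (𝓡∂ (n + 1)) g, z ≠ p → g₁ z = g z) :=
      exists_raise_criticalPoint hg ξ hξ hkn hp
  ----------------------------------------------------------------------------------------------
  -- Step 2 (4.2 on `g⁻¹[V_{k+}, (L_{k+1} + V_{(k+1)+})/2]`): lower `q` below the other points of index `k + 1`.
  ----------------------------------------------------------------------------------------------
  have hq₁ : q ∈ criticalSet (𝓡∂ (n + 1)) g₁ := by rw [hcrit₁]; exact hqc
  have hp₁ : p ∈ criticalSet (𝓡∂ (n + 1)) g₁ := by rw [hcrit₁]; exact hpc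
  have hq₁val : g₁ q = niceLevel n (k + 1) := by rw [hold₁ q hqc hqp, hqval]
  have hval₁ : ∀ z ∈ criticalSet (𝓡∂ (n + 1)) g, z ≠ p →
      g₁ z = niceLevel n (morseIndex (𝓡∂ (n + 1)) g z) := fun z hz hzp => by
    rw [hold₁ z hz hzp, hval z hz]
  obtain ⟨g₂, a₁', hg₂, hξ₂, hcrit₂, hind₂, hBq, hqa₁, ha₁', hoth₂, hlev₂, hold₂⟩ :
      ∃ g₂ : c.W → ℝ, ∃ a₁' : ℝ, c.IsMorseFunction g₂ ∧ IsGradientLike (𝓡∂ (n + 1)) g₂ ξ ∧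
        criticalSet (𝓡∂ (n + 1)) g₂ = criticalSet (𝓡∂ (n + 1)) g₁ ∧
        (∀ z ∈ criticalSet (𝓡∂ (n + 1)) g₁,
          morseIndex (𝓡∂ (n + 1)) g₂ z = morseIndex (𝓡∂ (n + 1)) g₁ z) ∧
        plusLevel n k < g₂ q ∧ g₂ q < a₁' ∧ a₁' < 1 ∧
        (∀ z ∈ criticalSet (𝓡∂ (n + 1)) g₂, z ≠ q → g₂ z ∉ Icc (plusLevel n k) a₁') ∧
        (∀ z, g₂ z = plusLevel n k ↔ g₁ z = plusLevel n k) ∧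
        (∀ z ∈ criticalSet (𝓡∂ (n + 1)) g₁, z ≠ q → g₂ z = g₁ z) := by
    -- the other critical points of index `k + 1`, and the top `kk` of the slab
    set P' : Set c.W := criticalSetOfIndex (𝓡∂ (n + 1)) g (k + 1) \ {q} with hP'
    set kk : ℝ := (niceLevel n (k + 1) + plusLevel n (k + 1)) / 2 with hkk
    have hLk : niceLevel n (k + 1) < kk := by rw [hkk]; linarith
    have hkP : kk < plusLevel n (k + 1) := by rw [hkk]; linarith
    have hk1 : kk < 1 := hkP.trans_le hV1le1
    have hpP' : p ∉ P' := fun h => by have := hp.2.symm.trans h.1.2; omega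
    -- the critical points of `g₁` in the closed slab `[V_{k+}, kk]` are `q` and `P'`
    have hslab : ∀ z ∈ criticalSet (𝓡∂ (n + 1)) g₁,
        g₁ z ∈ Icc (plusLevel n k) kk → z ∈ ({q} ∪ P' : Set c.W) := by
      intro z hz hzI
      rw [hcrit₁] at hz
      by_cases hzp : z = p
      · subst hzp; exact absurd hzI.1 (not_le.2 hpB)
      · have hj : morseIndex (𝓡∂ (n + 1)) g z = k + 1 := by
          rw [hval₁ z hz hzp] at hzI
          exact (niceLevel_mem_Icc_upper_iff n k _).1 hzI
        by_cases hzq : z = q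
        · exact Or.inl hzq
        · exact Or.inr ⟨⟨hz, hj⟩, hzq⟩
    by_cases hne : P'.Nonempty
    · -- 4.2 with `P = {q}` lowered to `aQ = (V_{k+} + L_{k+1})/2` and `P'` kept at `L_{k+1}`
      set aQ : ℝ := (plusLevel n k + niceLevel n (k + 1)) / 2 with haQ
      have haQ1 : plusLevel n k < aQ := by rw [haQ]; linarith
      have haQ2 : aQ < niceLevel n (k + 1) := by rw [haQ]; linarith
      have hPsub : ({q} ∪ P' : Set c.W) ⊆ criticalSet (𝓡∂ (n + 1)) g₁ := by
        rintro z (hz | hz)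
        · rw [mem_singleton_iff.1 hz]; exact hq₁
        · rw [hcrit₁]; exact hz.1.1
      have hdisjP : Disjoint ({q} : Set c.W) P' := disjoint_singleton_left.2 fun h => h.2 rfl
      have hvalP' : ∀ z ∈ P', g₁ z = niceLevel n (k + 1) := fun z hz => by
        rw [hval₁ z hz.1.1 (fun h => hpP' (h ▸ hz)), hz.1.2]
      have hK : Disjoint (⋃ z ∈ ({q} : Set c.W), trajectorySet (𝓡∂ (n + 1)) ξ z)
          (⋃ z ∈ P', trajectorySet (𝓡∂ (n + 1)) ξ z) := by
        refine disjoint_iUnion₂_left.2 fun z hz => disjoint_iUnion₂_right.2 fun z' hz' => ?_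
        rw [mem_singleton_iff] at hz
        rw [hz]
        exact hξ₁.disjoint_trajectorySet_of_apply_eq hv
          (hg₁.isMorse.contMDiff.mdifferentiable (by simp)) (fun h => hz'.2 h.symm)
          (hq₁val.trans (hvalP' z' hz').symm)
      obtain ⟨g₂, hg₂, hξ₂, hcrit₂, hvP, hvP', hnear, hIoo, hlocP, hlocP'⟩ :=
        h42 hg₁ ξ hξ₁ hVkpos (hVkL1.trans hLk) hk1
          (singleton_nonempty q) hne hdisjP hPsub hslab
          (show niceLevel n (k + 1) ∈ Ioo (plusLevel n k) kk from ⟨hVkL1, hLk⟩)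
          (show niceLevel n (k + 1) ∈ Ioo (plusLevel n k) kk from ⟨hVkL1, hLk⟩)
          (fun z hz => by rw [mem_singleton_iff.1 hz, hq₁val]) hvalP' hK
          ⟨haQ1, haQ2.trans hLk⟩ ⟨hVkL1, hLk⟩
      have hout : ∀ z, g₁ z ∉ Ioo (plusLevel n k) kk → g₂ z = g₁ z := fun z hz =>
        hnear.self_of_nhdsSet z hz
      have hnear' : ∀ z, g₁ z ∉ Ioo (plusLevel n k) kk → g₂ =ᶠ[𝓝 z] g₁ :=
        fun z hz => hnear.filter_mono (nhds_le_nhdsSet hz)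
      refine ⟨g₂, (aQ + niceLevel n (k + 1)) / 2, hg₂, hξ₂, hcrit₂, ?_, ?_, ?_, ?_, ?_, ?_, ?_⟩
      · -- indices
        intro z hz
        by_cases hzs : g₁ z ∈ Icc (plusLevel n k) kk
        · rcases hslab z hz hzs with hzq | hzP'
          · rw [mem_singleton_iff] at hzq
            subst hzq
            exact morseIndex_congr_of_eventuallyEq_add_const (hlocP z rfl)
          · exact morseIndex_congr_of_eventuallyEq_add_const (hlocP' z hzP')
        · exact morseIndex_congr_of_eventuallyEq (hnear' z fun h => hzs (Ioo_subset_Icc_self h))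
      · rw [hvP q rfl]; exact haQ1
      · rw [hvP q rfl]; linarith
      · linarith
      · -- the other critical points avoid `[V_{k+}, a₁']`
        intro z hz hzq hzI
        rw [hcrit₂] at hz
        by_cases hzs : g₁ z ∈ Icc (plusLevel n k) kk
        · rcases hslab z hz hzs with hzq' | hzP'
          · exact hzq (mem_singleton_iff.1 hzq')
          · rw [hvP' z hzP'] at hzI
            linarith [hzI.2]
        · have hzo : g₁ z ∉ Ioo (plusLevel n k) kk := fun h => hzs (Ioo_subset_Icc_self h)
          rw [hout z hzo] at hzI
          rw [mem_Icc, not_and_or, not_le, not_le] at hzs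
          rcases hzs with hlt | hlt
          · linarith [hzI.1]
          · linarith [hzI.2]
      · -- the level `V_{k+}` is unchanged
        intro z
        by_cases hzo : g₁ z ∈ Ioo (plusLevel n k) kk
        · constructor
          · intro h; exact absurd h (hIoo z hzo).1.ne'
          · intro h; exact absurd h hzo.1.ne'
        · rw [hout z hzo]
      · -- the critical points other than `q` keep their values
        intro z hz hzq
        by_cases hzs : g₁ z ∈ Icc (plusLevel n k) kk
        · rcases hslab z hz hzs with hzq' | hzP'
          · exact absurd (mem_singleton_iff.1 hzq') hzq
          · rw [hvP' z hzP', hvalP' z hzP']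
        · exact hout z fun h => hzs (Ioo_subset_Icc_self h)
    · -- `q` is the only critical point of index `k + 1`: nothing to do
      have hP'e : P' = ∅ := not_nonempty_iff_eq_empty.1 hne
      refine ⟨g₁, kk, hg₁, hξ₁, rfl, fun z _ => rfl, by rw [hq₁val]; exact hVkL1,
        by rw [hq₁val]; exact hLk, hk1, ?_, fun z => Iff.rfl, fun z _ _ => rfl⟩
      intro z hz hzq hzI
      rcases hslab z hz hzI with hzq' | hzP'
      · exact hzq (mem_singleton_iff.1 hzq')
      · rw [hP'e] at hzP'; exact hzP'
  ----------------------------------------------------------------------------------------------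
  -- Step 3 (Thm. 5.4 on the slab `g₂⁻¹[a₀, a₁']`): cancel `p` against `q`.
  ----------------------------------------------------------------------------------------------
  have hq₂ : q ∈ criticalSet (𝓡∂ (n + 1)) g₂ := by rw [hcrit₂]; exact hq₁
  have hp₂ : p ∈ criticalSet (𝓡∂ (n + 1)) g₂ := by rw [hcrit₂]; exact hp₁
  have hp₂val : g₂ p = g₁ p := hold₂ p hp₁ hqp.symm
  have hind₂₀ : ∀ z ∈ criticalSet (𝓡∂ (n + 1)) g,
      morseIndex (𝓡∂ (n + 1)) g₂ z = morseIndex (𝓡∂ (n + 1)) g z := fun z hz => by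
    rw [hind₂ z (by rw [hcrit₁]; exact hz), hind₁ z hz]
  have hpk : p ∈ criticalSetOfIndex (𝓡∂ (n + 1)) g₂ k := ⟨hp₂, by rw [hind₂₀ p hpc, hp.2]⟩
  have hqk : q ∈ criticalSetOfIndex (𝓡∂ (n + 1)) g₂ (k + 1) := ⟨hq₂, by rw [hind₂₀ q hqc, hq.2]⟩
  have honly : ∀ z ∈ criticalSet (𝓡∂ (n + 1)) g₂, g₂ z ∈ Icc a₀ a₁' → z = p ∨ z = q := by
    intro z hz hzI
    by_contra hzz
    rw [not_or] at hzz
    have h1 := hoth₂ z hz hzz.2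
    have h2 := hoth₁ z (hcrit₂ ▸ hz) hzz.1
    rw [← hold₂ z (hcrit₂ ▸ hz) hzz.2] at h2
    rcases le_total (g₂ z) (plusLevel n k) with hle | hle
    · exact h2 ⟨hzI.1, hle⟩
    · exact h1 ⟨hle, hzI.2⟩
  -- the level `V_{k+}` and the spheres in it are those of `g`
  have hpre : g₂ ⁻¹' {plusLevel n k} = g ⁻¹' {plusLevel n k} := by
    ext z
    simp only [mem_preimage, mem_singleton_iff]
    rw [hlev₂ z, hlev₁ z]
  have hSR : rightHandSphere (𝓡∂ (n + 1)) g₂ ξ p (plusLevel n k) =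
      rightHandSphere (𝓡∂ (n + 1)) g ξ p (plusLevel n k) := by
    unfold rightHandSphere; rw [hpre]
  have hSL : leftHandSphere (𝓡∂ (n + 1)) g₂ ξ q (plusLevel n k) =
      leftHandSphere (𝓡∂ (n + 1)) g ξ q (plusLevel n k) := by
    unfold leftHandSphere; rw [hpre]
  have hx₀' : rightHandSphere (𝓡∂ (n + 1)) g₂ ξ p (plusLevel n k) ∩
      leftHandSphere (𝓡∂ (n + 1)) g₂ ξ q (plusLevel n k) = {x₀} := by rw [hSR, hSL, hx₀]
  have htr' : IsTransverseInLevel (𝓡∂ (n + 1)) (g₂ ⁻¹' {plusLevel n k})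
      (rightHandSphere (𝓡∂ (n + 1)) g₂ ξ p (plusLevel n k))
      (leftHandSphere (𝓡∂ (n + 1)) g₂ ξ q (plusLevel n k)) x₀ := by
    rw [hpre, hSR, hSL]; exact htr
  obtain ⟨g₃, ξ₃, hg₃, -, hnear₃, -, hslab₃⟩ :=
    h54 hg₂ ξ hξ₂ ha₀ ha₁' hpk hqk (by rw [hp₂val]; exact ha₀p) (by rw [hp₂val]; exact hpB)
      hBq hqa₁ honly hx₀' htr'
  -- bookkeeping of the critical set of `g₃`
  have hnear₃' : ∀ z, g₂ z ∉ Icc a₀ a₁' → g₃ =ᶠ[𝓝 z] g₂ := fun z hz => by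
    have hzS : z ∈ {z | g₂ z ∉ Ioo a₀ a₁'} := fun h => hz (Ioo_subset_Icc_self h)
    exact hnear₃.filter_mono (nhds_le_nhdsSet hzS)
  have hcrit₃ : criticalSet (𝓡∂ (n + 1)) g₃ = criticalSet (𝓡∂ (n + 1)) g₂ \ {p, q} := by
    ext z
    simp only [Set.mem_sdiff, mem_criticalSet, mem_insert_iff, mem_singleton_iff, not_or]
    by_cases hzI : g₂ z ∈ Icc a₀ a₁'
    · constructor
      · intro h; exact absurd h (hslab₃ z hzI).2
      · rintro ⟨hz, hzp, hzq⟩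
        exact ((honly z hz hzI).elim hzp hzq).elim
    · rw [isMCriticalPt_congr_of_eventuallyEq (hnear₃' z hzI)]
      constructor
      · intro hz
        refine ⟨hz, ?_, ?_⟩
        · rintro rfl
          refine hzI ?_
          rw [mem_Icc, hp₂val]
          exact ⟨ha₀p.le, ((hpB.trans hBq).trans hqa₁).le⟩
        · rintro rfl
          exact hzI ⟨((ha₀p.trans hpB).trans hBq).le, hqa₁.le⟩
      · exact fun h => h.1
  have hind₃ : ∀ z ∈ criticalSet (𝓡∂ (n + 1)) g₃,
      morseIndex (𝓡∂ (n + 1)) g₃ z = morseIndex (𝓡∂ (n + 1)) g₂ z := by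
    intro z hz
    have hz' := hz
    rw [hcrit₃] at hz'
    refine morseIndex_congr_of_eventuallyEq (hnear₃' z fun hzI => ?_)
    simp only [Set.mem_sdiff, mem_insert_iff, mem_singleton_iff, not_or] at hz'
    exact (honly z hz'.1 hzI).elim hz'.2.1 hz'.2.2
  ----------------------------------------------------------------------------------------------
  -- Step 4 (Thm. 4.8): make the result nice again; conclude.
  ----------------------------------------------------------------------------------------------
  obtain ⟨g', hg', hcrit', hind'⟩ := hR hg₃
  have hcrit₃' : criticalSet (𝓡∂ (n + 1)) g₃ = criticalSet (𝓡∂ (n + 1)) g \ {p, q} := by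
    rw [hcrit₃, hcrit₂, hcrit₁]
  refine ⟨g', hg', hcrit'.trans hcrit₃', fun z hz => ?_⟩
  have hz₃ : z ∈ criticalSet (𝓡∂ (n + 1)) g₃ := by rw [hcrit'] at hz; exact hz
  have hzg : z ∈ criticalSet (𝓡∂ (n + 1)) g := by rw [hcrit₃'] at hz₃; exact hz₃.1
  rw [hind' z hz₃, hind₃ z hz₃, hind₂₀ z hzg]

end Cancel

end Summit.SmoothPoincare4.SmoothPoincare4.Theorems.AcyclicBisectionRigidity.Cancellation

end
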